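import Literature.Computability.Complexity.StockmeyerMachines
import Literature.Computability.Complexity.TruthTableFunctions
import Literature.Computability.Complexity.AdaptiveBPPSimulation
import Literature.Computability.Complexity.FPRASAmplification
import Literature.Computability.Complexity.FPRASTransfer
import Literature.Computability.Complexity.FPStringBricks
import Literature.Computability.Complexity.UniformProbBlocks
import Literature.Computability.Complexity.OracleEmpty
import Literature.Computability.Complexity.OracleProofs

/-!
# `NP ⊆ BPP` gives every `#P` function an FPRAS (oracle-free Stockmeyer) — the assembly step

Line `SketchIdeator1` for the crux `Summit.PneNP.PneNP.Theses.PhaseTwins.NoFBPPApproxAboveUniqueness`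
(stmt-PneNP-2717, route PneNP/PhaseTwins), stub `stub_leverAssembly` (the lead's assembly of the lever of the
calibration `X ⟺ ¬(NP ⊆ BPP)`), stated with its four ingredients as HYPOTHESES so that this file depends on
`Literature` only; the ingredients are the line's stubs S0–S3, all LANDED as theorems of this namespace:

* `h0` = `stub_counter_spec` (`Theorems/PhaseTwinsNoFBPPApproxAboveUniquenessCounterSpec.lean`): the guarantee
  of Stockmeyer's CONCRETE counter `StockMachine.counter R` with coin budget `StockMachine.coinPoly`;
* `h1` = `stub_ttFn_eq_adFn` (`…TtFnEqAdFn.lean`): the truth-table counter is the adaptive transducer of a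
  history-blind query generator;
* `h2` = `stub_exists_accF_good_eighth` (`…AccFEighth.lean`): pseudo-deterministic simulation of the answer
  string against a `BPP` oracle with failure `≤ 1/8` (`AdBPPSim.accF`);
* `h3` = `stub_coinSplit` (`…CoinSplit.lean`): the coin-splitting query transformer is in `FP`.

Conclusion: `NP ⊆ BPP → N ∈ SharpP → ThreeQuartersFPRAS N` (`stub_leverAssembly`) and `… → HasFPRAS N`
(`hasFPRAS_of_sharpP_of_NP_subset_BPP_of`, by JVV powering `ThreeQuartersFPRAS.hasFPRAS`). Proof
("`BPP^BPP = BPP`" inside Stockmeyer's transducer, Arora–Barak §7.5.2 / Ko 1982 / Zachos 1988): for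
`N x = #{y ∈ {0,1}^{rp|x|} | ⟨x,y⟩ ∈ R}`, `R ∈ P`, the counter `counter R = ttFn qryF qPoly outG (threshLang R)`
has the `NP` oracle `threshLang R ∈ NP ⊆ BPP`; the transducer splits its coins `U` into Stockmeyer's coins
`u = U ↾ ℓ₁` (confidence `8`) and a fresh block `r` on which the oracle answers are simulated by `accF`; on
good `(u, r)` the output IS the counter's answer; prefix/block probabilities (`uniformProb_take_le_of_le`,
`uniformProb_block_le`) and the union bound give failure `≤ 1/8 + 1/8 = 1/4`.

## References

* S. Arora, B. Barak, *Computational Complexity: A Modern Approach*, CUP 2009, §7.5.2 ("`BPP^BPP = BPP`"),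
  Thm. 7.10, §17.1.1 [AroraBarak2009].
* L. J. Stockmeyer, *On approximation algorithms for #P*, SIAM J. Comput. 14 (1985); S. Aaronson,
  A. Arkhipov, Theory of Computing 9 (2013), Thm. 4.1 [AaronsonArkhipovToC2013].
* M. R. Jerrum, L. G. Valiant, V. V. Vazirani, TCS 43 (1986), Lemma 6.1 [JerrumValiantVazirani1986].
-/

set_option linter.dupNamespace false

namespace Summit.PneNP.PneNP.Theorems.NoFBPPApproxAboveUniqueness

open Literature.Computability.Complexity
open _root_.Computability Polynomial Brick Plumb AdQuery AdBPPSim StockMachine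

/-- The history-blind generator is in `FP`. [folklore] -/
theorem blindQ_mem_FP {Q : List Bool → List Bool} (hQ : Q ∈ FP) : Q ∘ fanoutFn fstF (polyFn X ∘ sndF) ∈ FP :=
  comp_mem_FP hQ (fanoutFn_mem_FP fstF_mem_FP (comp_mem_FP (polyFn_mem_FP X) sndF_mem_FP))

/-- The length of a counting query `⟨x, 1^m, 1^{kη}, 1^{kδ}, u⟩`. [folklore] -/
theorem length_countQuery (x : List Bool) (m kη kδ : ℕ) (u : List Bool) :
    (countQuery x m kη kδ u).length = 4 * x.length + 4 * m + 4 * kη + 2 * kδ + 14 + u.length := by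
  simp only [countQuery, length_boolPair, APTransfer.length_unary]
  omega

/-- Stockmeyer's threshold language for a relation `R ∈ P` is in `NP` (`threshLang_mem_NPRel` at the
empty oracle, `NPRel_empty`). [cite: AaronsonArkhipovToC2013, Thm. 4.1 (p. 175)] -/
theorem threshLang_mem_NP {R : Language Bool} (hR : R ∈ Classes.P) : threshLang R ∈ Nondeterministic.NP := by
  have h := threshLang_mem_NPRel (O := Oracle.empty) (P_subset_PRel_holds Oracle.empty hR)
  rwa [NPRel_empty] at h

/-- **Stub (lead) — oracle-free Stockmeyer, assembly step.** Given the four ingredients S0–S3 as hypotheses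
(`h0`–`h3`, see the module docstring; all landed), if `NP ⊆ BPP` then every `#P` function has a textbook
`3/4`-FPRAS. For `N x = #{y ∈ {0,1}^{rp|x|} | ⟨x,y⟩ ∈ R}`, `R ∈ P`: the transducer splits its coins `U`
into Stockmeyer's coins `u = U ↾ ℓ₁` (confidence `8`, `ℓ₁ = coinPoly(|x| + rp|x| + kη + 8)`) and a fresh
block `r` on which the `NP`-oracle `threshLang R ∈ NP ⊆ BPP` of the truth-table counter
`counter R = ttFn qryF qPoly outG (threshLang R)` (S1: `= adFn` of the history-blind generator) is replaced
by the pseudo-deterministic simulation `accF` (S2, failure `≤ 1/8`); on good `(u, r)` the output IS the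
counter's answer (S0, failure `≤ 1/8`); prefix and block events (`uniformProb_take_le_of_le`,
`uniformProb_block_le`) and the union bound give failure `≤ 1/4`.
[cite: AroraBarak2009, §7.5.2 with Thm. 7.10] -/
theorem stub_leverAssembly
    (h0 : ∀ (R : Language Bool) (x : List Bool) (m kη kδ : ℕ), 0 < kη → 0 < kδ →
      uniformProb (coinPoly.eval (x.length + m + kη + kδ))
        {u | ¬ IsApproxCount kη (countWitnesses R m x) (countEstimate (counter R) x m kη kδ u)} ≤ 1 / (kδ : ℝ))
    (h1 : ∀ (Q : List Bool → List Bool) (q : Polynomial ℕ) (G : List Bool → List Bool) (A : Language Bool)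
      (x : List Bool), ttFn Q q G A x = adFn (Q ∘ fanoutFn fstF (polyFn X ∘ sndF)) q G A x)
    (h2 : ∀ {A : Language Bool}, A ∈ BPP → ∀ {Qg : List Bool → List Bool}, Qg ∈ FP → ∀ q : Polynomial ℕ,
      ∃ B ∈ Classes.P, ∃ t T : Polynomial ℕ, ∀ x : List Bool,
        uniformProb (T.eval x.length)
          {r | accF B t Qg q (boolPair x r) ≠ adBits Qg A x (q.eval x.length)} ≤ 1 / 8)
    (h3 : ∀ (rp c₁ T : Polynomial ℕ) (k₀ : ℕ) {H : List Bool → List Bool}, H ∈ FP →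
      ∃ F' ∈ FP, ∀ (x U : List Bool) (kη kδ : ℕ),
        F' (countQuery x 0 kη kδ U) =
          H (boolPair
              (countQuery x (rp.eval x.length) kη k₀
                (U.take (c₁.eval (x.length + rp.eval x.length + kη + k₀))))
              ((U.drop (c₁.eval (x.length + rp.eval x.length + kη + k₀))).take
                (T.eval (countQuery x (rp.eval x.length) kη k₀
                  (U.take (c₁.eval (x.length + rp.eval x.length + kη + k₀)))).length))))
    (hNP : Nondeterministic.NP ⊆ BPP) {N : List Bool → ℕ} (hN : N ∈ SharpP) : ThreeQuartersFPRAS N := by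
  obtain ⟨R, hR, rp, hcount⟩ := hN
  -- the oracle of Stockmeyer's counter is in `BPP`
  have hL : threshLang R ∈ BPP := hNP (threshLang_mem_NP hR)
  -- the history-blind generator of the counter
  set Qg : List Bool → List Bool := qryF ∘ fanoutFn fstF (polyFn X ∘ sndF) with hQg
  have hQgFP : Qg ∈ FP := blindQ_mem_FP qryF_mem_FP
  -- the simulation of the answer string
  obtain ⟨B, hB, t, T, hsim⟩ := h2 hL hQgFP qPoly
  -- the inner map `⟨w, r⟩ ↦ outG ⟨w, accF ⟨w, r⟩⟩`
  set H : List Bool → List Bool := outG ∘ fanoutFn fstF (accF B t Qg qPoly) with hH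
  have hHFP : H ∈ FP := comp_mem_FP outG_mem_FP (fanoutFn_mem_FP fstF_mem_FP (accF_mem_FP hQgFP hB))
  have hHval : ∀ w r : List Bool, H (boolPair w r) = outG (boolPair w (accF B t Qg qPoly (boolPair w r))) := by
    intro w r
    simp [hH]
  -- the transducer
  obtain ⟨F', hF', hF'eq⟩ := h3 rp coinPoly T 8 hHFP
  -- the coin budget: `ℓ₁ + T(|w|)` bounded by a polynomial in `|x| + kη`
  set L1B : Polynomial ℕ := coinPoly.comp (X + rp + 8) with hL1B
  set cBud : Polynomial ℕ := L1B + T.comp (4 * X + 4 * rp + 30 + L1B) with hcBud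
  refine ⟨F', hF', cBud, fun x kη hkη => ?_⟩
  -- names
  set n := x.length + kη with hn
  set m := rp.eval x.length with hm
  set ℓ₁ := coinPoly.eval (x.length + m + kη + 8) with hℓ₁
  set W₀ := 4 * x.length + 4 * m + 4 * kη + 2 * 8 + 14 + ℓ₁ with hW₀
  set ℓ₂ := T.eval W₀ with hℓ₂
  -- bounds
  have hm_le : m ≤ rp.eval n := TM2Iter.eval_mono rp (by omega)
  have hℓ₁_le : ℓ₁ ≤ L1B.eval n := by
    simp only [hL1B, eval_comp, eval_add, eval_X, eval_ofNat, hℓ₁]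
    exact TM2Iter.eval_mono coinPoly (by omega)
  have hW₀_le : W₀ ≤ (4 * X + 4 * rp + 30 + L1B : Polynomial ℕ).eval n := by
    simp only [eval_add, eval_mul, eval_X, eval_ofNat]
    omega
  have hbud : ℓ₁ + ℓ₂ ≤ cBud.eval n := by
    have h2 : ℓ₂ ≤ (T.comp (4 * X + 4 * rp + 30 + L1B)).eval n := by
      rw [eval_comp, hℓ₂]
      exact TM2Iter.eval_mono T hW₀_le
    simp only [hcBud, eval_add] at h2 ⊢
    omega
  obtain ⟨d, hd⟩ : ∃ d, cBud.eval n = ℓ₁ + ℓ₂ + d := ⟨cBud.eval n - (ℓ₁ + ℓ₂), by omega⟩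
  -- the two bad events
  set BadS : Set (List Bool) :=
    {u | ¬ IsApproxCount kη (countWitnesses R m x) (countEstimate (counter R) x m kη 8 u)} with hBadS
  set wOf : List Bool → List Bool := fun u => countQuery x m kη 8 u with hwOf
  set BadR : List Bool → Set (List Bool) := fun u =>
    {r | accF B t Qg qPoly (boolPair (wOf u) r) ≠ adBits Qg (threshLang R) (wOf u) (qPoly.eval (wOf u).length)}
    with hBadR
  have hPS : uniformProb (ℓ₁ + ℓ₂ + d) {U | U.take ℓ₁ ∈ BadS} ≤ 1 / 8 := by
    refine APTransfer.uniformProb_take_le_of_le (by omega) BadS ?_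
    have h := h0 R x m kη 8 hkη (by norm_num)
    norm_num at h ⊢
    exact h
  have hPR : uniformProb (ℓ₁ + ℓ₂ + d) {U | (U.drop ℓ₁).take ℓ₂ ∈ BadR (U.take ℓ₁)} ≤ 1 / 8 := by
    refine uniformProb_block_le BadR fun u hu => ?_
    have hlen : (wOf u).length = W₀ := by
      rw [hwOf, length_countQuery, hu]
    have h := hsim (wOf u)
    rw [hℓ₂, ← hlen]
    exact h
  -- good coins give a good answer
  have hgood : ∀ U : List Bool, U.length = cBud.eval n →
      U ∈ {U | ¬ IsApproxCount kη (N x) (countEstimate F' x 0 kη 4 U)} →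
        U ∈ {U | U.take ℓ₁ ∈ BadS} ∪ {U | (U.drop ℓ₁).take ℓ₂ ∈ BadR (U.take ℓ₁)} := by
    intro U hU hbad
    by_contra hnot
    simp only [Set.mem_union, Set.mem_setOf_eq, not_or, hBadS, hBadR, ne_eq, not_not] at hnot
    obtain ⟨hS, hRgood⟩ := hnot
    apply hbad
    -- unfold the estimate
    have hu : (U.take ℓ₁).length = ℓ₁ := by
      rw [List.length_take, hU]; omega
    have hlen : (wOf (U.take ℓ₁)).length = W₀ := by
      rw [hwOf, length_countQuery, hu]
    have hval : countEstimate F' x 0 kη 4 U = countEstimate (counter R) x m kη 8 (U.take ℓ₁) := by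
      rw [countEstimate_def, countEstimate_def, hF'eq x U kη 4, hHval]
      simp only [← hm, ← hℓ₁]
      have hw : countQuery x m kη 8 (U.take ℓ₁) = wOf (U.take ℓ₁) := rfl
      rw [hw, hlen, ← hℓ₂, hRgood]
      show _ = decodeNat (ttFn qryF qPoly outG (threshLang R) _)
      rw [h1, adFn_apply]
    rw [hval, hcount x, ← hm]
    exact hS
  -- union bound
  calc uniformProb (cBud.eval n) {U | ¬ IsApproxCount kη (N x) (countEstimate F' x 0 kη 4 U)}
      ≤ uniformProb (cBud.eval n) ({U | U.take ℓ₁ ∈ BadS} ∪ {U | (U.drop ℓ₁).take ℓ₂ ∈ BadR (U.take ℓ₁)}) :=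
        APTransfer.uniformProb_mono_len hgood
    _ ≤ uniformProb (cBud.eval n) {U | U.take ℓ₁ ∈ BadS} +
          uniformProb (cBud.eval n) {U | (U.drop ℓ₁).take ℓ₂ ∈ BadR (U.take ℓ₁)} :=
        uniformProb_union_le _ _ _
    _ ≤ 1 / 8 + 1 / 8 := by rw [hd]; exact add_le_add hPS hPR
    _ = 1 / 4 := by norm_num

end Summit.PneNP.PneNP.Theorems.NoFBPPApproxAboveUniqueness
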